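import Literature.Analysis.FluidPDE.BeltramiFlows
import Mathlib.Analysis.Calculus.MeanValue
import HarnessLib

/-!
# Barrier: Beltrami data do not switch off the Navier–Stokes nonlinearity or the pressure gradient

Barrier catalogue entry for `NavierStokesRegularity` (D-0021), companion of
`Literature.Barriers.NavierStokesRegularity.PressureSlaving` (which kills «p ≡ 0 / ∇p absorbed»
with the Taylor–Green datum) and of `Literature.Barriers.NavierStokesRegularity.ExactModeLineDecayLaws`
(decay laws on the Stokes shear-mode line). ZERO fact debt: every statement below is a theorem over
the tree's Arnold–Beltrami–Childress flow `Literature.Analysis.FluidPDE.abc`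
(`BeltramiFlows.lean`: `convect_abc`, `isClassicalNSSolutionOn_abc`, `strongBeltramiVelocity_zero`).

## What is proved

For a Beltrami field `curl v = λ v` the convective term is a gradient, `(v·∇)v = ∇(|v|²/2)`
(`IsBeltrami.convect_eq_gradient`, MB Prop. 2.10), so the viscous flow `e^{−λ²νt} v` solves
Navier–Stokes with the Bernoulli pressure `p = −½e^{−2λ²νt}|v|²` (MB p. 61). A recurring claimed
step reads this as «the nonlinearity VANISHES on Beltrami data» / «the pressure is constant
(∇p = 0)» / «(u·∇)u = 0 pointwise for such flows», and then propagates a linear law. On the ABC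
flow `v = abc 1 1 1` this is false at the level of two point values: `|v(0)|² = 3` and
`|v(π/2, 0, 0)|² = 5` (`normSq_abc_zero`, `normSq_abc_quarterPt`), hence `|v|²/2` is not constant
(`bernoulli_abc_not_const`), hence — by the mean-value theorem `is_const_of_fderiv_eq_zero` — its
gradient, which IS `(v·∇)v`, is not identically zero (`convect_abc_not_zero`), and the Bernoulli
pressure of the viscous ABC solution has a non-vanishing gradient at `t = 0`
(`gradient_pressure_abc_not_zero`). The law forms (`no_law_convect_zero`, `no_law_pressure_const`,
`no_law_gradient_pressure_zero`) negate the corresponding universally quantified sentences over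
classical solutions `IsClassicalNSSolutionOn univ ν 0 u p` on `ℝ³` (ℤ³·2π-periodic smooth data,
Clay class (B) read on `ℝ³`, as in `PressureSlaving`).

## References

* [MajdaBertozziCUP2002] A. J. Majda, A. L. Bertozzi, *Vorticity and Incompressible Flow*, CUP 2002,
  §2.3.2 Example 2.8 eq. (2.49), Prop. 2.10, p. 61.
-/

noncomputable section

open Real Set Function InnerProductSpace
open scoped RealInnerProductSpace

namespace Literature.Barriers.NavierStokesRegularity.Beltrami

open Literature.Analysis.FluidPDE Literature.Analysis.FluidPDE.ABC

/-- Physical space `ℝ³ = EuclideanSpace ℝ (Fin 3)`. [cite: MajdaBertozziCUP2002, §2.3.2] -/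
abbrev E3 := EuclideanSpace ℝ (Fin 3)

/-- The quarter-turn point `(π/2, 0, 0)`. [cite: MajdaBertozziCUP2002, §2.3.2 Example 2.8 eq. (2.49)] -/
def quarterPt : E3 := EuclideanSpace.single 0 (π / 2)

/-- `|abc(0)|² = 3` (`abc 1 1 1 0 = (1, 1, 1)`). [cite: MajdaBertozziCUP2002, §2.3.2 Example 2.8 eq. (2.49)] -/
theorem normSq_abc_zero : ‖abc 1 1 1 (0 : E3)‖ ^ 2 = 3 := by
  rw [EuclideanSpace.norm_sq_eq, Fin.sum_univ_three, abc_apply_zero, abc_apply_one, abc_apply_two]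
  simp
  norm_num

/-- `|abc(π/2, 0, 0)|² = 5` (`abc 1 1 1 (π/2,0,0) = (1, 2, 0)`).
[cite: MajdaBertozziCUP2002, §2.3.2 Example 2.8 eq. (2.49)] -/
theorem normSq_abc_quarterPt : ‖abc 1 1 1 quarterPt‖ ^ 2 = 5 := by
  rw [EuclideanSpace.norm_sq_eq, Fin.sum_univ_three, abc_apply_zero, abc_apply_one, abc_apply_two]
  simp [quarterPt]
  norm_num

/-- The Bernoulli potential `|v|²/2` of the ABC flow is not constant.
[cite: MajdaBertozziCUP2002, §2.3.2 Example 2.8 eq. (2.49) and Prop. 2.10] -/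
theorem bernoulli_abc_not_const : ¬ ∃ c : ℝ, ∀ x : E3, ‖abc 1 1 1 x‖ ^ 2 / 2 = c := by
  rintro ⟨c, hc⟩
  have h0 := hc 0
  have h1 := hc quarterPt
  rw [normSq_abc_zero] at h0
  rw [normSq_abc_quarterPt] at h1
  linarith

/-- A differentiable real function on `E3` whose gradient vanishes identically is constant
(mean-value theorem). [folklore] -/
private theorem eq_of_gradient_eq_zero {f : E3 → ℝ} (hf : Differentiable ℝ f)
    (h : ∀ x, gradient f x = 0) (x y : E3) : f x = f y := by
  refine is_const_of_fderiv_eq_zero hf (fun z => ?_) x y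
  have hz := h z
  rw [gradient, LinearIsometryEquiv.map_eq_zero_iff] at hz
  exact hz

/-- **The ABC nonlinearity is not identically zero**: `(v·∇)v = ∇(|v|²/2) ≢ 0` for `v = abc 1 1 1`.
[cite: MajdaBertozziCUP2002, §2.3.2 Example 2.8 eq. (2.49) and Prop. 2.10] -/
theorem convect_abc_not_zero : ¬ ∀ x : E3, convect (abc 1 1 1) (abc 1 1 1) x = 0 := by
  intro h
  have hd : Differentiable ℝ (fun y : E3 => ‖abc 1 1 1 y‖ ^ 2 / 2) :=
    (((contDiff_abc 1 1 1 (n := 1)).norm_sq ℝ).div_const 2).differentiable one_ne_zero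
  have hz : ∀ x, gradient (fun y : E3 => ‖abc 1 1 1 y‖ ^ 2 / 2) x = 0 := fun x => by
    rw [← convect_abc]; exact h x
  have hc := eq_of_gradient_eq_zero hd hz 0 quarterPt
  rw [normSq_abc_zero, normSq_abc_quarterPt] at hc
  norm_num at hc

/-- The Bernoulli pressure of the viscous ABC solution at `t = 0` is `−|v|²/2`.
[cite: MajdaBertozziCUP2002, §2.3.2 p. 61] -/
theorem pressure_abc_zero (ν : ℝ) :
    strongBeltramiPressure ν 1 (abc 1 1 1) 0 = fun x => -(‖abc 1 1 1 x‖ ^ 2 / 2) := by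
  funext x
  simp [strongBeltramiPressure]

/-- **The ABC pressure gradient is not identically zero at `t = 0`.**
[cite: MajdaBertozziCUP2002, §2.3.2 Example 2.8 eq. (2.49) and p. 61] -/
theorem gradient_pressure_abc_not_zero (ν : ℝ) :
    ¬ ∀ x : E3, gradient (strongBeltramiPressure ν 1 (abc 1 1 1) 0) x = 0 := by
  intro h
  rw [pressure_abc_zero] at h
  have hd : Differentiable ℝ (fun y : E3 => -(‖abc 1 1 1 y‖ ^ 2 / 2)) :=
    (((contDiff_abc 1 1 1 (n := 1)).norm_sq ℝ).div_const 2).neg.differentiable one_ne_zero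
  have hc := eq_of_gradient_eq_zero hd h 0 quarterPt
  rw [normSq_abc_zero, normSq_abc_quarterPt] at hc
  norm_num at hc

/-! ## Law forms (negations of universally quantified claimed steps) -/

/-- **No pointwise law `(u·∇)u = 0`** holds for all classical Navier–Stokes solutions on `E3`
(any viscosity): the viscous ABC flow violates it at `t = 0`.
[cite: MajdaBertozziCUP2002, §2.3.2 Example 2.8 eq. (2.49) and p. 61] -/
theorem no_law_convect_zero (ν : ℝ) :
    ¬ ∀ (u : ℝ → E3 → E3) (p : ℝ → E3 → ℝ), IsClassicalNSSolutionOn univ ν 0 u p →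
      ∀ t : ℝ, ∀ x : E3, convect (u t) (u t) x = 0 := by
  intro h
  have h0 := h _ _ (isClassicalNSSolutionOn_abc 1 1 1 ν) 0
  rw [strongBeltramiVelocity_zero] at h0
  exact convect_abc_not_zero h0

/-- **No law «the pressure is (spatially) constant»** holds for all classical Navier–Stokes
solutions on `E3`: the Bernoulli pressure of the viscous ABC flow is not constant at `t = 0`.
[cite: MajdaBertozziCUP2002, §2.3.2 Example 2.8 eq. (2.49) and p. 61] -/
theorem no_law_pressure_const (ν : ℝ) :
    ¬ ∀ (u : ℝ → E3 → E3) (p : ℝ → E3 → ℝ), IsClassicalNSSolutionOn univ ν 0 u p →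
      ∀ t : ℝ, ∃ c : ℝ, ∀ x : E3, p t x = c := by
  intro h
  obtain ⟨c, hc⟩ := h _ _ (isClassicalNSSolutionOn_abc 1 1 1 ν) 0
  rw [pressure_abc_zero] at hc
  exact bernoulli_abc_not_const ⟨-c, fun x => by have := hc x; linarith⟩

/-- **No pointwise law `∇p = 0`** holds for all classical Navier–Stokes solutions on `E3`.
[cite: MajdaBertozziCUP2002, §2.3.2 Example 2.8 eq. (2.49) and p. 61] -/
theorem no_law_gradient_pressure_zero (ν : ℝ) :
    ¬ ∀ (u : ℝ → E3 → E3) (p : ℝ → E3 → ℝ), IsClassicalNSSolutionOn univ ν 0 u p →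
      ∀ t : ℝ, ∀ x : E3, gradient (p t) x = 0 := by
  intro h
  exact gradient_pressure_abc_not_zero ν (h _ _ (isClassicalNSSolutionOn_abc 1 1 1 ν) 0)

/-! ## Barrier block -/

/-- Barrier catalogue entry (D-0021).

technique_class: "Beltrami linearisation read as VANISHING of the nonlinearity / of the pressure
gradient: any step asserting, for all classical solutions (or for Beltrami / Trkalian / ABC data),
`(u·∇)u = 0` pointwise, `p` spatially constant, or `∇p = 0`, and propagating a linear (heat /
Stokes) law from it"
statement: "On the viscous ABC flow (`abc 1 1 1`, MB Example 2.8, p. 61): `|v(0)|² = 3 ≠ 5 =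
|v(π/2,0,0)|²`, so `(v·∇)v = ∇(|v|²/2) ≢ 0` and the Bernoulli pressure `−½e^{−2νt}|v|²` has
`∇p(0,·) ≢ 0`; hence none of the three laws holds over `IsClassicalNSSolutionOn univ ν 0`"
scope_caveats: "what IS true: `(v·∇)v` is a GRADIENT on Beltrami data and is absorbed by the
pressure (MB Prop. 2.10) — the flow then decays at the exact Stokes rate; the barrier bites only
the reading «gradient ⇒ zero». Witness is 2π-periodic smooth (Clay class (B) read on `E3`), not
finite-energy on `E3`: a law restricted to Schwartz-class data on `E3` is not touched here (use
`PressureSlaving`'s pressure-Poisson argument with a compactly supported datum instead)"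
evasions_known: "claims that keep `∇(|u|²/2)` in the pressure and use only the resulting LINEAR
decay `e^{−λ²νt}` (true; see `ExactModeLineDecayLaws` for what such exact lines do and do not
bound)"
because: two explicit point values of `|abc|²` + the mean-value theorem
(`is_const_of_fderiv_eq_zero`) + `convect_abc` + `isClassicalNSSolutionOn_abc`.
[cite: MajdaBertozziCUP2002, §2.3.2 Example 2.8 eq. (2.49), Prop. 2.10 and p. 61] -/
def BeltramiNonlinearity : Prop :=
  ∀ ν : ℝ,
    (¬ ∀ (u : ℝ → E3 → E3) (p : ℝ → E3 → ℝ), IsClassicalNSSolutionOn univ ν 0 u p →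
        ∀ t : ℝ, ∀ x : E3, convect (u t) (u t) x = 0) ∧
      (¬ ∀ (u : ℝ → E3 → E3) (p : ℝ → E3 → ℝ), IsClassicalNSSolutionOn univ ν 0 u p →
        ∀ t : ℝ, ∃ c : ℝ, ∀ x : E3, p t x = c) ∧
      (¬ ∀ (u : ℝ → E3 → E3) (p : ℝ → E3 → ℝ), IsClassicalNSSolutionOn univ ν 0 u p →
        ∀ t : ℝ, ∀ x : E3, gradient (p t) x = 0)

/-- The barrier holds (zero fact debt). [cite: MajdaBertozziCUP2002, §2.3.2 Example 2.8 and p. 61] -/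
theorem beltramiNonlinearity_holds : BeltramiNonlinearity := fun ν =>
  ⟨no_law_convect_zero ν, no_law_pressure_const ν, no_law_gradient_pressure_zero ν⟩

/-- `BeltramiNonlinearity` — `_holds` alias of `beltramiNonlinearity_holds` above under the fact's exact name (appended
2026-08-28, D-0026 bookkeeping: the proof term is the existing theorem of this file; no statement,
definition or attribute is edited; no new named fact; the ledger's debt table listed the fact
unproved). [cite: MajdaBertozziCUP2002, §2.3.2 Example 2.8 and p. 61] -/
theorem _root_.Literature.Barriers.NavierStokesRegularity.Beltrami.BeltramiNonlinearity_holds :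
    BeltramiNonlinearity :=
  _root_.Literature.Barriers.NavierStokesRegularity.Beltrami.beltramiNonlinearity_holds

end Literature.Barriers.NavierStokesRegularity.Beltrami

end

-- WHAT THIS IS NOT: not a claim about NS regularity or blow-up; not a claim about any author beyond the typed locator.
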